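import Summits.Ventures.QEC.Census.CertCoverBatch
import Summits.Ventures.QEC.Census.BB.S8_126_w6_k12_01061B01.CoreDefs
import HarnessLib

set_option Elab.async false
set_option maxRecDepth 200000

/-!
# `[[252,12,16]]` one-level cover certificate of `S8_126_w6_k12_01061B01` — LEVEL-1→0 coset problems 23…39 (deep problems [0] excluded: `ProbDeep*.lean`) as COMPACT data
(`ProbData`: U, f, σ, y₀, allow; qec-type-10 `CertCoverBatch.mkCoset` rebuilds each `CosetProb` in the kernel) + their verdict
`probsOK cov covR hx hx1 D1 lxd 14` (one `decide +kernel`; 17 problems, depths f=0:8 f=1:9 f=2:0 f=3:0, est. 100.0 s).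
qec-search-1 g5 (pattern of search-9 g5 `Probs*`); data from JSON `level10.problems` (sha256 75f002ace624d82a…). Data + decided check; KERNEL.
-/

namespace Summit.Ventures.QEC.Census.S8_126_w6_k12_01061B01

open Matrix Summit.Ventures.QEC.Census Literature.InformationTheory.QuantumCodes

/-- Problems 23…39 (17): `⟨U, f, σ, y₀, allow⟩`. -/
def probs03 : List ProbData := [
    ⟨580369406391385173545452032, 0, 1155176878152091648, 348170637204186781618012672, [0]⟩,
    ⟨657816216712699154872143360, 0, 1157430877022599168, 657655647027783650156478976, [0]⟩,
    ⟨773722021172301092444183552, 0, 5765739196786438144, 154751963478697428463389696, [0]⟩,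
    ⟨773910874326440612894608384, 1, 1158555677401034752, 618979473603531513222136832, [0]⟩,
    ⟨1315736315111727625599455232, 0, 1165317674012524544, 1315396303569787431812071424, [0]⟩,
    ⟨1547774514611758712997549056, 1, 1163063675142033408, 1237949493250725250299069440, [0]⟩,
    ⟨1547887892912522849840792576, 0, 5779254393782145024, 309787279322658652955869184, [0]⟩,
    ⟨3095501795182394913203430400, 1, 1172079670087159808, 619583936508835228249236480, [0]⟩,
    ⟨6190956356323667313615193088, 1, 1190111661588025344, 1239158419061332680353268736, [0]⟩,
    ⟨12381865478606212114438718464, 1, 1226175643516014592, 9903529768311437569376125952, [0]⟩,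
    ⟨24763683723171301716085769216, 1, 1298303607371993088, 4956633640504764353478721536, [0]⟩,
    ⟨49527320212301480919379870720, 1, 1442559535083950080, 39614090711376736949068891136, [0]⟩,
    ⟨49556324987239547755260150912, 0, 1442277785233527296, 9903520323506414237122692224, [0]⟩,
    ⟨99054593190561839325968073728, 1, 1731071390507864064, 79228171968797136121992578048, [0]⟩,
    ⟨168359883131255464511674123392, 0, 288230397901804032, 158456325038043560978728751745, []⟩,
    ⟨168408249608772733942975038464, 0, 288512147752226816, 168369554528300497652792033280, [0]⟩,
    ⟨198080115480373277765425169536, 1, 281492431311360, 198070406294887499399349015169, [1152921504606846976, 9444732965739290427392, 38685626227668133590597632]⟩]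

set_option maxHeartbeats 400000000 in
/-- Every problem of this chunk passes (`mkCoset` elimination + `cosetOKD` + fast `σ` + depth + `BU`-evenness + label checks). -/
theorem probs03_ok : probsOK S8_126_w6_k12_01061B01.cov covR hx hx1 D1 lxd 14 probs03 = true := by
  decide +kernel

/-- Pointwise form. -/
theorem probs03_all : ∀ x ∈ S8_126_w6_k12_01061B01.probs03, probOK cov covR hx hx1 D1 lxd 14 x = true := by
  have h := probs03_ok
  rwa [probsOK, List.all_eq_true] at h

end Summit.Ventures.QEC.Census.S8_126_w6_k12_01061B01
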